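import Summits.BirchSwinnertonDyer.BirchSwinnertonDyer.Theses.KatoDescentPotSupersingular
import HarnessLib

/-!
# BC3 BIRTH SKELETON v1 (ARCHIVED as an alternative line by plan g22; the registered skeleton is Lines/birth.lean v2) — crux `WildCoatesSujathaResidue` (item stmt-BirchSwinnertonDyer-19942; route K9 =
# `Theses/KatoDescentPotSupersingular.lean` rev 21, rank 7; planner bsd-potss-plan g21, 2026-08-27)

The crux is Coates–Sujatha's Conjecture A (fine-Selmer-dual reading, `p = 3`) on the O6 RESIDUE classes:
non-CM wild-3 rank-0 curves of class O6 with `W[3]` irreducible and the 3-adic tower not onto, whose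
isogeny class has a lattice-optimal member `W₀` that is EITHER Manin-dirty (`3 ∣ c(D₀)`; census ∅) OR has
`3 ∣ ∏ c_ℓ(W₀)` carried by no single admissible prime `q` (`q = 3` allowed; `q ≠ 3` must be
multiplicative with `3 ∤ c_3(W₀)`) — census = the C/D multi-Tamagawa rows of
HOME/k8t-c4/K9-19386-sharp-tamagawa-primes-g6.tsv; per-row certificates exist (Deo–Ray–Sujatha
(c1)(c2)(c3); the landed CM-anchor instance road p499727 `…FineSelmerRankOneCMAnchor`).

THE CUT — by RESIDUE CLASS (the crux's own disjunction; different literatures, different cheapest roads):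
* `stub_residue_maninDirty` (S1, size L–XL): Conj A at 3 on the Manin-dirty O6 residue class. Roads:
  (a) EMPTINESS — `3 ∤ c(D₀)` for the optimal member at a wild potentially-good 3 (Mazur 1978 `p ∣ c ⇒
  p² ∣ 4N` does not exclude it; Edixhoven 1991 Thm. 3 covers only `p ≥ 11`; Česnavičius–Neururer–Saha
  arXiv:1911.09446 main thm `ord_3 c ≤ ord_3 deg φ` (with their caveat at `27 ∣ N`: some `p′ ∣ N`,
  `p′ ≡ 2 mod 3`); Cremona [Cre19] `c = 1` for all optimal `N ≤ 500000` — check first); (b) Conj A on the class (Coates–Sujatha 2005 Thm. 3.4 ⇐ classical `μ = 0` of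
  `ℚ(W[3])_cyc`; Deo–Ray–Sujatha arXiv:2202.09937). WHY IT MIGHT FAIL: Conj A open; a Manin-dirty optimal
  O6 curve beyond the census with `μ(Y) ≠ 0` refutes it. SOURCES: CoatesSujatha2005 Thm 3.4; Mazur1978;
  arXiv:1911.09446; arXiv:2202.09937.
* `stub_residue_noSingleCarrier` (S2, size XL, conjecture-grade): Conj A at 3 on the multi-carrier O6
  residue class. Roads: (a) CONGRUENCE ANCHOR via Lim–Sujatha 2018 Prop. 3.2 (tree fact
  `LimSujatha2018.prop32_fineSelmerDual_moduleFinite_iff_of_torsionIso`; instance road p499727) — but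
  conjA-anchor g4: 6 ROWFAIL rows admit NO CM congruent curve, so a non-CM `μ = 0` anchor is needed there;
  (b) classical `μ(ℚ(W[3])_cyc) = 0` ⇒ Conj A (CS05 Thm. 3.4; vocabulary = plan g21 definition request);
  (c) per-row Deo–Ray–Sujatha certificates do not make a class theorem. WHY IT MIGHT FAIL: Conj A open; one
  multi-carrier row with `μ ≠ 0` refutes it. SOURCES: CoatesSujatha2005; LimSujatha2018 Prop 3.2;
  Lim2017FineSelmer §3; arXiv:2202.09937.
`WildCoatesSujathaResidue_of` is the case split. Two `sorry`s, both in stubs; neither stub is the crux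
(one residue class each) and neither implies `O6Sharp`.
-/

noncomputable section

open scoped Classical

open WeierstrassCurve Literature.NumberTheory.EllipticCurves
open Literature.NumberTheory.EllipticCurves.ModularForms
open Literature.NumberTheory.EllipticCurves.Rank1Residual

namespace Summit.BirchSwinnertonDyer.BirchSwinnertonDyer.Cruxes.WildCoatesSujathaResidue.BirthV1

/-- Statement of `stub_residue_maninDirty` (S1): Conjecture A at `3` (fine-Selmer-dual reading) on the
O6 residue rows whose lattice-optimal isogenous member is Manin-dirty, `3 ∣ c(D₀)`.
[CoatesSujatha2005 Thm 3.4; Mazur1978; arXiv:1911.09446; arXiv:2202.09937] -/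
abbrev Sig.stub_residue_maninDirty : Prop :=
  ∀ (W : WeierstrassCurve ℚ) [W.IsElliptic] [W.IsGloballyMinimal] [Fact (3 : ℕ).Prime],
    W.analyticRank = 0 → Summit.BirchSwinnertonDyer.Rank1Residual.Additive.ClassO6 W 3 →
    W.HasIrreducibleModPGaloisRep 3 → ¬ (∀ n : ℕ, W.HasSurjectiveModNGaloisRep (3 ^ n : ℕ)) →
    ¬ W.HasCM →
    (∃ (W₀ : WeierstrassCurve ℚ) (_ : W₀.IsElliptic) (_ : W₀.IsGloballyMinimal)
        (_ : NeZero (W₀.conductorNorm ℤ))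
        (D₀ : ModularParametrizationData W₀ (W₀.conductorNorm ℤ)),
      WeierstrassCurve.IsIsogenous W W₀ ∧
      (∀ z ∈ D₀.L.lattice, ∃ w ∈ periodLattice D₀.f, z = (D₀.c : ℂ) * w) ∧ (3 : ℤ) ∣ D₀.c) →
    ∀ (κ : ZpExtension ℚ 3), κ.IsCyclotomic →
      ∃ (γ : Field.absoluteGaloisGroup ℚ) (Df : W.FineSelmerDualData κ γ),
        Module.Finite ℤ_[3] (RestrictScalars ℤ_[3] (IwasawaAlgebra 3) Df.X)

/-- Statement of `stub_residue_noSingleCarrier` (S2): Conjecture A at `3` (fine-Selmer-dual reading) on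
the O6 residue rows whose lattice-optimal isogenous member has `3 ∣ ∏ c_ℓ` carried by no single
admissible prime. [CoatesSujatha2005; LimSujatha2018 Prop 3.2; Lim2017FineSelmer §3; arXiv:2202.09937] -/
abbrev Sig.stub_residue_noSingleCarrier : Prop :=
  ∀ (W : WeierstrassCurve ℚ) [W.IsElliptic] [W.IsGloballyMinimal] [Fact (3 : ℕ).Prime],
    W.analyticRank = 0 → Summit.BirchSwinnertonDyer.Rank1Residual.Additive.ClassO6 W 3 →
    W.HasIrreducibleModPGaloisRep 3 → ¬ (∀ n : ℕ, W.HasSurjectiveModNGaloisRep (3 ^ n : ℕ)) →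
    ¬ W.HasCM →
    (∃ (W₀ : WeierstrassCurve ℚ) (_ : W₀.IsElliptic) (_ : W₀.IsGloballyMinimal)
        (_ : NeZero (W₀.conductorNorm ℤ))
        (D₀ : ModularParametrizationData W₀ (W₀.conductorNorm ℤ)),
      WeierstrassCurve.IsIsogenous W W₀ ∧
      (∀ z ∈ D₀.L.lattice, ∃ w ∈ periodLattice D₀.f, z = (D₀.c : ℂ) * w) ∧
      (3 ∣ W₀.tamagawaProduct ∧ ¬ ∃ (q : ℕ) (_ : Fact q.Prime),
        q ∣ W₀.conductorNorm ℤ ∧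
        (q ≠ 3 → ¬ q ^ 2 ∣ W₀.conductorNorm ℤ ∧
          ¬ 3 ∣ (W₀.baseChange ℚ_[3]).localTamagawaNumber ℤ_[3]) ∧
        padicValNat 3 W₀.tamagawaProduct ≤
          padicValNat 3 ((W₀.baseChange ℚ_[q]).localTamagawaNumber ℤ_[q]))) →
    ∀ (κ : ZpExtension ℚ 3), κ.IsCyclotomic →
      ∃ (γ : Field.absoluteGaloisGroup ℚ) (Df : W.FineSelmerDualData κ γ),
        Module.Finite ℤ_[3] (RestrictScalars ℤ_[3] (IwasawaAlgebra 3) Df.X)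

/-- S1 — registered stub. -/
theorem stub_residue_maninDirty : Sig.stub_residue_maninDirty := by
  sorry

/-- S2 — registered stub. -/
theorem stub_residue_noSingleCarrier : Sig.stub_residue_noSingleCarrier := by
  sorry

/-- **The crux from the two stubs**: case split on the residue class of the optimal member,
concluding the K9 route decl BY NAME. -/
theorem WildCoatesSujathaResidue_of (h₁ : Sig.stub_residue_maninDirty)
    (h₂ : Sig.stub_residue_noSingleCarrier) :
    Summit.BirchSwinnertonDyer.BirchSwinnertonDyer.Theses.KatoDescentPotSupersingular.WildCoatesSujathaResidue := by
  unfold Summit.BirchSwinnertonDyer.BirchSwinnertonDyer.Theses.KatoDescentPotSupersingular.WildCoatesSujathaResidue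
  intro W _ _ _ hr hcl hirr hns hcm hopt κ hκ
  obtain ⟨W₀, hW₀e, hW₀m, hW₀n, D₀, hiso, hlat, hdisj⟩ := hopt
  rcases hdisj with hc | ⟨htam, hno⟩
  · exact h₁ W hr hcl hirr hns hcm ⟨W₀, hW₀e, hW₀m, hW₀n, D₀, hiso, hlat, hc⟩ κ hκ
  · exact h₂ W hr hcl hirr hns hcm ⟨W₀, hW₀e, hW₀m, hW₀n, D₀, hiso, hlat, htam, hno⟩ κ hκ

end Summit.BirchSwinnertonDyer.BirchSwinnertonDyer.Cruxes.WildCoatesSujathaResidue.BirthV1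

end
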